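import Summits.HodgeConjecture.HodgeCM.Automorphic.ThetaCarrier_1

/-! PORT of `HodgeCM/Automorphic/ThetaCarrier.lean` (HodgeCMPerL run 82) — part 2: continuation of `Summits.HodgeConjecture.HodgeCM.Automorphic.ThetaCarrier_1` (split at a top-level declaration boundary by port_pkg.py; scope re-opened below; declarations unchanged). -/

-- port_pkg: scope re-opened for this part (file-level context, then the namespace/section stack open at the cut)
set_option autoImplicit false
noncomputable section
open scoped InnerProductSpace
namespace HodgeCM
open HodgeCM.Prior.Perl34File HodgeCM.Prior.Perl34File.Perl34
namespace Universe
variable (U : Universe)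
/-- **The theta carrier**: `U.ThetaModel` with its three Prior-record fields replaced by the prop-free carriers —
a record with NO propositional content.  Field names and docstrings as in `ThetaModel`. -/
structure ThetaCarrier where
  /-- `L²([G_U])` -/
  HG : ∀ (L : CMField) (ι₁ : L →+* ℂ), HermSpace3 L ι₁ → Type
  [instHG₁ : ∀ L ι₁ V, NormedAddCommGroup (HG L ι₁ V)]
  [instHG₂ : ∀ L ι₁ V, InnerProductSpace ℂ (HG L ι₁ V)]
  [instHG₃ : ∀ L ι₁ V, CompleteSpace (HG L ι₁ V)]
  /-- PerL §3.1: degree-two classes of `P_Γ` as `L²` functions on `[G_U]` -/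
  emb : ∀ {L : CMField} {ι₁ : L →+* ℂ} {V : HermSpace3 L ι₁} (Γ : Level V),
    U.CohC (U.pms L ι₁ V Γ) 2 →ₗ[ℂ] HG L ι₁ V
  /-- the covering `P_{Γ'} → P_Γ` for `Γ' ≤ Γ` -/
  cover : ∀ {L : CMField} {ι₁ : L →+* ℂ} {V : HermSpace3 L ι₁} (Γ Γ' : Level V),
    Γ'.Γ ≤ Γ.Γ → U.Mor (U.pms L ι₁ V Γ') (U.pms L ι₁ V Γ)
  /-- sign recipe, first half -/
  kappa : ∀ (K L : CMField), (K →+* L) → (L →+* ℂ) → (L →+* ℂ) → (K →+* ℂ)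
  /-- sign recipe, second half -/
  frameSign : ∀ (L : CMField), (L →+* ℂ) → (L →+* ℂ) → Bool
  /-- `L²([U(W)])` -/
  H : ∀ {L : CMField} {ι₁ : L →+* ℂ}, HermSpace3 L ι₁ → SeesawCtx L → Type
  /-- `C([G_U])` -/
  CG : ∀ {L : CMField} {ι₁ : L →+* ℂ}, HermSpace3 L ι₁ → SeesawCtx L → Type
  /-- `U(W)(𝔸)` -/
  G : ∀ {L : CMField} {ι₁ : L →+* ℂ}, HermSpace3 L ι₁ → SeesawCtx L → Type
  /-- `𝒮^κ` -/
  SK : ∀ {L : CMField} {ι₁ : L →+* ℂ}, HermSpace3 L ι₁ → SeesawCtx L → Type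
  /-- index types of the isotypic decompositions -/
  SigIdx : ∀ {L : CMField} {ι₁ : L →+* ℂ}, HermSpace3 L ι₁ → SeesawCtx L → Type
  SigIdxG : ∀ {L : CMField} {ι₁ : L →+* ℂ}, HermSpace3 L ι₁ → SeesawCtx L → Type
  [instH₁ : ∀ {L : CMField} {ι₁ : L →+* ℂ} (V : HermSpace3 L ι₁) (c : SeesawCtx L), NormedAddCommGroup (H V c)]
  [instH₂ : ∀ {L : CMField} {ι₁ : L →+* ℂ} (V : HermSpace3 L ι₁) (c : SeesawCtx L), InnerProductSpace ℂ (H V c)]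
  [instH₃ : ∀ {L : CMField} {ι₁ : L →+* ℂ} (V : HermSpace3 L ι₁) (c : SeesawCtx L), CompleteSpace (H V c)]
  [instCG₁ : ∀ {L : CMField} {ι₁ : L →+* ℂ} (V : HermSpace3 L ι₁) (c : SeesawCtx L), NormedAddCommGroup (CG V c)]
  [instCG₂ : ∀ {L : CMField} {ι₁ : L →+* ℂ} (V : HermSpace3 L ι₁) (c : SeesawCtx L), NormedSpace ℂ (CG V c)]
  [instG₁ : ∀ {L : CMField} {ι₁ : L →+* ℂ} (V : HermSpace3 L ι₁) (c : SeesawCtx L), Group (G V c)]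
  [instG₂ : ∀ {L : CMField} {ι₁ : L →+* ℂ} (V : HermSpace3 L ι₁) (c : SeesawCtx L), TopologicalSpace (G V c)]
  [instSK : ∀ {L : CMField} {ι₁ : L →+* ℂ} (V : HermSpace3 L ι₁) (c : SeesawCtx L), TopologicalSpace (SK V c)]
  /-- the prop-free torus-free core of the context -/
  core : ∀ {L : CMField} {ι₁ : L →+* ℂ} (V : HermSpace3 L ι₁) (c : SeesawCtx L),
    CoreCarrier (H V c) (HG L ι₁ V) (CG V c) (G V c) (SK V c) (SigIdx V c) (SigIdxG V c)
  /-- the prop-free (12) torus side -/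
  t12 : ∀ {L : CMField} {ι₁ : L →+* ℂ} (V : HermSpace3 L ι₁) (c : SeesawCtx L), TorusCarrier (core V c)
  /-- the prop-free (34) torus side -/
  t34 : ∀ {L : CMField} {ι₁ : L →+* ℂ} (V : HermSpace3 L ι₁) (c : SeesawCtx L), TorusCarrier (core V c)
  /-- the theta one-forms of type `Ψ_i` at level `Γ` -/
  Theta : ∀ {L : CMField} {ι₁ : L →+* ℂ} (V : HermSpace3 L ι₁), SeesawCtx L → Fin 4 → ∀ Γ : Level V,
    Set (U.CohC (U.pms L ι₁ V Γ) 1)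

attribute [instance] ThetaCarrier.instHG₁ ThetaCarrier.instHG₂ ThetaCarrier.instHG₃ ThetaCarrier.instH₁
  ThetaCarrier.instH₂ ThetaCarrier.instH₃ ThetaCarrier.instCG₁ ThetaCarrier.instCG₂ ThetaCarrier.instG₁
  ThetaCarrier.instG₂ ThetaCarrier.instSK

namespace ThetaCarrier

variable {U}
variable (D : U.ThetaCarrier)

/-- **The analytic hypotheses of a theta carrier**: in every seesaw context, the 5 core axioms and the 7 axioms of each
torus side (`CoreCarrier.Analytic`, `TorusCarrier.Analytic`) — 20 named propositions per context.  A `Prop`; enters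
every theorem ONLY as an explicit hypothesis `(hA : D.Analytic)`. -/
structure Analytic : Prop where
  core : ∀ {L : CMField} {ι₁ : L →+* ℂ} (V : HermSpace3 L ι₁) (c : SeesawCtx L), (D.core V c).Analytic
  t12 : ∀ {L : CMField} {ι₁ : L →+* ℂ} (V : HermSpace3 L ι₁) (c : SeesawCtx L), (D.t12 V c).Analytic
  t34 : ∀ {L : CMField} {ι₁ : L →+* ℂ} (V : HermSpace3 L ι₁) (c : SeesawCtx L), (D.t34 V c).Analytic

end ThetaCarrier

namespace ThetaModel

variable {U}

/-- **The theta model of a carrier**: gen 1's `U.ThetaModel` RECONSTRUCTED from a prop-free carrier `D` and its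
analytic hypotheses `hA` (the Prior records rebuilt by `toIsolationCore` / `toTorusData`).  Every landed theorem over
`(T : U.ThetaModel)` applies verbatim to `ThetaModel.ofCarrier D hA`. -/
def ofCarrier (D : U.ThetaCarrier) (hA : D.Analytic) : U.ThetaModel where
  HG := D.HG
  emb := D.emb
  cover := D.cover
  kappa := D.kappa
  frameSign := D.frameSign
  H := D.H
  CG := D.CG
  G := D.G
  SK := D.SK
  SigIdx := D.SigIdx
  SigIdxG := D.SigIdxG
  core := fun V c => (D.core V c).toIsolationCore (hA.core V c)
  t12 := fun V c => (D.t12 V c).toTorusData (hA.core V c) (hA.t12 V c)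
  t34 := fun V c => (D.t34 V c).toTorusData (hA.core V c) (hA.t34 V c)
  Theta := D.Theta

variable (D : U.ThetaCarrier) (hA : D.Analytic)

/-- (Ported verbatim from the HodgeCMPerL package; no docstring in the source.) -/
@[simp] theorem ofCarrier_HG : (ofCarrier D hA).HG = D.HG := rfl
/-- (Ported verbatim from the HodgeCMPerL package; no docstring in the source.) -/
theorem ofCarrier_Theta {L : CMField} {ι₁ : L →+* ℂ} (V : HermSpace3 L ι₁) (c : SeesawCtx L) (i : Fin 4)
    (Γ : Level V) : (ofCarrier D hA).Theta V c i Γ = D.Theta V c i Γ := rfl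
/-- (Ported verbatim from the HodgeCMPerL package; no docstring in the source.) -/
@[simp] theorem ofCarrier_kappa : (ofCarrier D hA).kappa = D.kappa := rfl
/-- (Ported verbatim from the HodgeCMPerL package; no docstring in the source.) -/
@[simp] theorem ofCarrier_frameSign : (ofCarrier D hA).frameSign = D.frameSign := rfl
/-- (Ported verbatim from the HodgeCMPerL package; no docstring in the source.) -/
theorem ofCarrier_core {L : CMField} {ι₁ : L →+* ℂ} (V : HermSpace3 L ι₁) (c : SeesawCtx L) :
    (ofCarrier D hA).core V c = (D.core V c).toIsolationCore (hA.core V c) := rfl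
/-- (Ported verbatim from the HodgeCMPerL package; no docstring in the source.) -/
theorem ofCarrier_t12 {L : CMField} {ι₁ : L →+* ℂ} (V : HermSpace3 L ι₁) (c : SeesawCtx L) :
    (ofCarrier D hA).t12 V c = (D.t12 V c).toTorusData (hA.core V c) (hA.t12 V c) := rfl
/-- (Ported verbatim from the HodgeCMPerL package; no docstring in the source.) -/
theorem ofCarrier_t34 {L : CMField} {ι₁ : L →+* ℂ} (V : HermSpace3 L ι₁) (c : SeesawCtx L) :
    (ofCarrier D hA).t34 V c = (D.t34 V c).toTorusData (hA.core V c) (hA.t34 V c) := rfl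
/-- The (12)-side `S₁₂` of the reconstructed model IS the carrier's `closure (span …)` — `S12_def` by `rfl`. -/
theorem ofCarrier_S12 {L : CMField} {ι₁ : L →+* ℂ} (V : HermSpace3 L ι₁) (c : SeesawCtx L) :
    ((ofCarrier D hA).t12 V c).S12 = (D.t12 V c).S12 := rfl
/-- (Ported verbatim from the HodgeCMPerL package; no docstring in the source.) -/
theorem ofCarrier_S34 {L : CMField} {ι₁ : L →+* ℂ} (V : HermSpace3 L ι₁) (c : SeesawCtx L) :
    ((ofCarrier D hA).t34 V c).S12 = (D.t34 V c).S12 := rfl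

end ThetaModel

end Universe

end HodgeCM

end
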